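import Mathlib

/-!
# Tier4/Common/Forms — the holomorphic-form side of the ball quotient `X`: wedge and `L²(X)` pairing

Blind re-derivation cell `pub-hodge-repro`, Tier 4 (README §9–§10), seat t4-typer-1 (gen 0).  Target tree path
`lean/Summits/Ventures/HodgeRepro/Tier4/Common/Forms.lean`.  THE SEAM between the geometric side of the statement
(P) of `route/TIER3.md` §1 item 3 (`Tier4/Common/Geometry.lean`, typer-1) and its automorphic side
(`Tier4/Common/Automorphic.lean`, typer-2): ONE type `Form` of holomorphic forms on the compact `2`-ball quotient
`X`, ONE wedge product and ONE `L²(X)` pairing, so that the two sides of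
«`f^*Ω_s = θ(μ_0) ∧ θ(μ_1)` and `f^*Ω_{s̄} = θ(μ_2) ∧ θ(μ_3)`, ⟨f^*Ω_s, f^*Ω_{s̄}⟩_{L²(X)} ≠ 0»
are written with the same `∧` and the same `⟨·,·⟩`.

WHAT IS TYPED.  `X` is a compact complex surface (a compact quotient of the unit `2`-ball by a torsion-free
arithmetic lattice of `U(V)`, `V` an anisotropic hermitian `3`-space over the Galois CM field `E′`).  Its
holomorphic forms `H^{1,0}(X) ⊕ H^{2,0}(X)` (Hodge decomposition of a compact Kähler surface; every holomorphic
form is closed and harmonic) carry the wedge product `H^{1,0} × H^{1,0} → H^{2,0}` and the Hodge / `L²` inner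
product `⟨α, β⟩_{L²(X)} = ∫_X α ∧ ⋆β̄`, ℂ-linear in `α`, conjugate-linear in `β`, hermitian and positive definite
(a non-zero form has positive norm).  `FormAlgebra Form` records exactly these objects and these textbook
properties over an abstract ℂ-module `Form` — every field is either an object of the statement or a property
that the actual `(H^{•,0}(X), ∧, ⟨·,·⟩_{L²(X)})` has by definition; nothing about theta lifts, Hecke translates
or corners is here (that is `Geometry.lean` / `Automorphic.lean`).

WHAT AN INTERFACE CAN AND CANNOT SAY.  Every field is a parameter.  A theorem proved over `FormAlgebra Form` is a
theorem about every instantiation, hence exactly as strong as the properties listed and no stronger.  Nothing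
here says anything about the status of the Hodge conjecture for CM abelian varieties, which is NOT proved
(HC_CM is NOT proved by anyone in this repository).
-/

set_option autoImplicit false

noncomputable section

namespace Summit.Ventures.HodgeRepro.Tier4.Common

open Complex

/-- **The holomorphic-form algebra of `X`**: the wedge product and the `L²(X)` Hodge pairing on the ℂ-module
`Form` of holomorphic forms of `X`, with the holomorphic `1`-forms `H10 = H^{1,0}(X)` and `2`-forms
`H20 = H^{2,0}(X)` as submodules, and the textbook properties the statement (P) uses: the wedge of two `1`-forms
is a `2`-form and is alternating; the pairing is hermitian, positive definite, and vanishes between forms of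
different degree (the `L²` inner product of a `1`-form and a `2`-form is `0`); the space is finite-dimensional. -/
structure FormAlgebra (Form : Type) [AddCommGroup Form] [Module ℂ Form] where
  /-- the wedge product `α ∧ β`, ℂ-bilinear -/
  wedge : Form →ₗ[ℂ] Form →ₗ[ℂ] Form
  /-- the `L²(X)` Hodge inner product `⟨α, β⟩_{L²(X)} = ∫_X α ∧ ⋆β̄`, ℂ-linear in `α` and conjugate-linear in `β` -/
  hodge : Form →ₗ[ℂ] Form →ₗ⋆[ℂ] ℂ
  /-- the holomorphic `1`-forms `H^{1,0}(X)` -/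
  H10 : Submodule ℂ Form
  /-- the holomorphic `2`-forms `H^{2,0}(X)` -/
  H20 : Submodule ℂ Form
  /-- the wedge of two holomorphic `1`-forms is a holomorphic `2`-form -/
  wedge_mem : ∀ α β : Form, α ∈ H10 → β ∈ H10 → wedge α β ∈ H20
  /-- the wedge of `1`-forms is alternating: `α ∧ α = 0` -/
  wedge_self : ∀ α : Form, α ∈ H10 → wedge α α = 0
  /-- the pairing is hermitian: `⟨β, α⟩ = conj ⟨α, β⟩` -/
  hodge_hermitian : ∀ α β : Form, hodge β α = starRingEnd ℂ (hodge α β)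
  /-- the pairing is positive definite: `⟨α, α⟩` is a positive real number for `α ≠ 0` -/
  hodge_pos : ∀ α : Form, α ≠ 0 → 0 < (hodge α α).re
  /-- forms of different degree are orthogonal: `⟨α, β⟩ = 0` for `α ∈ H^{1,0}`, `β ∈ H^{2,0}` -/
  hodge_degree : ∀ α β : Form, α ∈ H10 → β ∈ H20 → hodge α β = 0
  /-- the holomorphic forms of the compact surface `X` form a finite-dimensional ℂ-space
  (`dim H^{1,0} = q(X)`, `dim H^{2,0} = p_g(X)`) -/
  finiteDimensional : FiniteDimensional ℂ Form

namespace FormAlgebra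

variable {Form : Type} [AddCommGroup Form] [Module ℂ Form] (A : FormAlgebra Form)

/-- The wedge of `1`-forms is anticommutative: `α ∧ β = −(β ∧ α)` (from `(α + β) ∧ (α + β) = 0`). -/
theorem wedge_anticomm (α β : Form) (hα : α ∈ H10 A) (hβ : β ∈ H10 A) :
    A.wedge α β = -A.wedge β α := by
  have h := A.wedge_self (α + β) (A.H10.add_mem hα hβ)
  have hαα := A.wedge_self α hα
  have hββ := A.wedge_self β hβ
  simp only [map_add, LinearMap.add_apply, hαα, hββ, zero_add, add_zero] at h
  rw [add_comm] at h
  exact eq_neg_of_add_eq_zero_left h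

/-- The pairing of a form with itself is real: `im ⟨α, α⟩ = 0`. -/
theorem hodge_self_im (α : Form) : (A.hodge α α).im = 0 := by
  have h := A.hodge_hermitian α α
  have : (A.hodge α α).im = -(A.hodge α α).im := by
    conv_lhs => rw [h]
    simp [Complex.conj_im]
  linarith

/-- Positive definiteness, contrapositive form: `⟨α, α⟩ = 0` forces `α = 0`. -/
theorem eq_zero_of_hodge_self_eq_zero (α : Form) (h : A.hodge α α = 0) : α = 0 := by
  by_contra hne
  have := A.hodge_pos α hne
  rw [h] at this
  simp at this

/-- The pairing of the zero form with anything is `0`. -/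
theorem hodge_zero_left (β : Form) : A.hodge 0 β = 0 := by simp

/-- The pairing of anything with the zero form is `0`. -/
theorem hodge_zero_right (α : Form) : A.hodge α 0 = 0 := by simp

/-- **The non-vanishing predicate of (P)**: `⟨Ω, Ω′⟩_{L²(X)} ≠ 0`. -/
def PairingNonzero (Ω Ω' : Form) : Prop := A.hodge Ω Ω' ≠ 0

/-- A non-zero pairing forces both forms to be non-zero. -/
theorem ne_zero_of_pairingNonzero {Ω Ω' : Form} (h : A.PairingNonzero Ω Ω') : Ω ≠ 0 ∧ Ω' ≠ 0 := by
  refine ⟨?_, ?_⟩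
  · rintro rfl; exact h (A.hodge_zero_left Ω')
  · rintro rfl; exact h (A.hodge_zero_right Ω)

/-- The pairing of a form with itself is non-zero iff the form is non-zero. -/
theorem pairingNonzero_self_iff (Ω : Form) : A.PairingNonzero Ω Ω ↔ Ω ≠ 0 := by
  constructor
  · exact fun h => (A.ne_zero_of_pairingNonzero h).1
  · intro hne h
    exact hne (A.eq_zero_of_hodge_self_eq_zero Ω h)

/-- Conjugate symmetry of the non-vanishing predicate. -/
theorem pairingNonzero_comm (Ω Ω' : Form) : A.PairingNonzero Ω Ω' ↔ A.PairingNonzero Ω' Ω := by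
  unfold PairingNonzero
  rw [A.hodge_hermitian Ω' Ω]
  simp

end FormAlgebra

end Summit.Ventures.HodgeRepro.Tier4.Common
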